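import Mathlib.Tactic.LinearCombination
import Mathlib.Tactic.Abel
import Summits.MatrixMultiplication.OmegaCensus.DihedralLawModOneNonCube
import Summits.MatrixMultiplication.OmegaCensus.DicyclicLawQuotientCyclicShapeB
import HarnessLib

/-!
# Dicyclic type (`c₀ ≠ 0`): a shape-B law triple forces `A/⟨c₀⟩` cyclic — TPP wrapper

ω-census, family (b3).  Framing: lottery ticket; floor = certified bounds/negative ranges.

`quot_cyclic_of_shapeB_tpp` (and its mirrored / two-orientation forms `_tpp'`, `_tpp_or`): a TPP triple of a
dihedral-like group over `A` with `c₀ ≠ 0` whose coset parts have sizes `(c, c+1 | 2, 2 | 1, 1)` and which attains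
`3|S||T||U| + 8 = 8|A|` forces `A = ⟨g⟩ ∪ (c₀ + ⟨g⟩)` (`A/⟨c₀⟩` cyclic).  The derivation of the additive normal form
from the TPP is that of `DihedralLawModOneShapeB.two_cosets_of_shapeB_tpp` verbatim (and the mirrored case that of
`DihedralLawModOneNonCube.two_cosets_of_shapeB_tpp'`); only the final additive lemma is the periodic one
(`quot_cyclic_of_shapeB_offsets`, `DicyclicLawQuotientCyclicShapeB.lean`).
-/

namespace Summit.MatrixMultiplication.OmegaCensus

open Literature.Combinatorics.Additive Finset

section DihedralLike

variable {A : Type*} [AddCommGroup A] [DecidableEq A] [Fintype A] {G : Type} [Group G] [DecidableEq G]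
  {ρ τ : A → G} {c₀ : A} {S T U : Finset G}

/-- **Shape `(c, c+1 | 2, 2 | 1, 1)` at the law with `c₀ ≠ 0` forces `A = ⟨g⟩ ∪ (c₀ + ⟨g⟩)`.** [folklore] -/
theorem quot_cyclic_of_shapeB_tpp
    (hρρ : ∀ a b, ρ a * ρ b = ρ (a + b)) (hρτ : ∀ a b, ρ a * τ b = τ (b - a))
    (hτρ : ∀ a b, τ a * ρ b = τ (a + b)) (hττ : ∀ a b, τ a * τ b = ρ (c₀ + b - a))
    (hρ : Function.Injective ρ) (hτ : Function.Injective τ) (hne : ∀ a b, ρ a ≠ τ b)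
    (hsurj : ∀ g, (∃ a, ρ a = g) ∨ (∃ a, τ a = g)) (h : TripleProductProperty S T U)
    (hS : (univ.filter fun a : A => τ a ∈ S).card = (univ.filter fun a : A => ρ a ∈ S).card + 1)
    (hT₀ : (univ.filter fun a : A => ρ a ∈ T).card = 2) (hT₁ : (univ.filter fun a : A => τ a ∈ T).card = 2)
    (hU₀ : (univ.filter fun a : A => ρ a ∈ U).card = 1) (hU₁ : (univ.filter fun a : A => τ a ∈ U).card = 1)
    (hV : 3 * (S.card * T.card * U.card) + 8 = 8 * Fintype.card A) (hc₀ : c₀ ≠ 0) :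
    ∃ g : A, ∀ x : A, x ∈ AddSubgroup.zmultiples g ∨ x + c₀ ∈ AddSubgroup.zmultiples g := by
  have h2c : c₀ + c₀ = 0 := two_c0_eq_zero hρτ hτρ hττ hτ
  set S₀ := univ.filter fun a : A => ρ a ∈ S with hS₀
  set S₁ := univ.filter fun a : A => τ a ∈ S with hS₁
  obtain ⟨b₁, b₂, hb12, hT₀e⟩ := card_eq_two.1 hT₀
  obtain ⟨b₃, b₄, hb34, hT₁e⟩ := card_eq_two.1 hT₁
  obtain ⟨u, hU₀e⟩ := card_eq_one.1 hU₀
  obtain ⟨u', hU₁e⟩ := card_eq_one.1 hU₁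
  -- membership of the parts
  have mS₀ : ∀ a ∈ S₀, ρ a ∈ S := fun a ha => (mem_filter.1 ha).2
  have mS₁ : ∀ a ∈ S₁, τ a ∈ S := fun a ha => (mem_filter.1 ha).2
  have mT₀ : ∀ b ∈ ({b₁, b₂} : Finset A), ρ b ∈ T := fun b hb => by
    have hb' : b ∈ univ.filter fun a : A => ρ a ∈ T := by rw [hT₀e]; exact hb
    exact (mem_filter.1 hb').2
  have mT₁ : ∀ b ∈ ({b₃, b₄} : Finset A), τ b ∈ T := fun b hb => by
    have hb' : b ∈ univ.filter fun a : A => τ a ∈ T := by rw [hT₁e]; exact hb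
    exact (mem_filter.1 hb').2
  have mU₀ : ∀ c ∈ ({u} : Finset A), ρ c ∈ U := fun c hc => by
    have hc' : c ∈ univ.filter fun a : A => ρ a ∈ U := by rw [hU₀e]; exact hc
    exact (mem_filter.1 hc').2
  have mU₁ : ∀ c ∈ ({u'} : Finset A), τ c ∈ U := fun c hc => by
    have hc' : c ∈ univ.filter fun a : A => τ a ∈ U := by rw [hU₁e]; exact hc
    exact (mem_filter.1 hc').2
  have mS₀c : ∀ a ∈ S₀, cond false (τ a) (ρ a) ∈ S := mS₀
  have mS₁c : ∀ a ∈ S₁, cond true (τ a) (ρ a) ∈ S := mS₁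
  have mT₀c : ∀ b ∈ ({b₁, b₂} : Finset A), cond false (τ b) (ρ b) ∈ T := mT₀
  have mT₁c : ∀ b ∈ ({b₃, b₄} : Finset A), cond true (τ b) (ρ b) ∈ T := mT₁
  have mU₀c : ∀ c ∈ ({u} : Finset A), cond false (τ c) (ρ c) ∈ U := mU₀
  have mU₁c : ∀ c ∈ ({u'} : Finset A), cond true (τ c) (ρ c) ∈ U := mU₁
  -- `|A| = 2|S₀| + 4|S₁|`
  have cS := card_eq_parts' hρ hτ hne hsurj S
  have cT := card_eq_parts' hρ hτ hne hsurj T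
  have cU := card_eq_parts' hρ hτ hne hsurj U
  rw [hT₀, hT₁] at cT
  rw [hU₀, hU₁] at cU
  have hA : Fintype.card A = 2 * S₀.card + 4 * S₁.card := by
    rw [cS, cT, cU] at hV
    have : S.card = S₀.card + S₁.card := cS
    omega
  -- base sumset facts
  have cs := card_sumset' hρρ hττ hρ hτ h
  have d₁ := disjoint_sumset₁' hρρ hρτ hτρ hττ hne h
  have d₂ := disjoint_sumset₂' hρρ hρτ hτρ hττ hne h
  have d₃ := disjoint_sumset₃' hρρ hρτ hτρ hττ hne h
  -- triangle 2 (T2): `B₀₁₁ ⊔ B₁₀₁ ⊔ B₁₁₀ = A`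
  have D12 := (d₁ true mS₁ mT₀ mU₁c mS₀ mT₁).symm      -- B₀₁₁ ∩ B₁₀₁ = ∅
  have D13 := d₃ true mS₀ mT₁c mU₁ mS₁ mU₀             -- B₀₁₁ ∩ B₁₁₀ = ∅
  have D23 := (d₂ true mS₁c mT₁ mU₀ mS₁c mT₀ mU₁).symm -- B₁₀₁ ∩ B₁₁₀ = ∅
  have c011 := cs false true true mS₀c mT₁c mU₁c
  have c101 := cs true false true mS₁c mT₀c mU₁c
  have c110 := cs true true false mS₁c mT₁c mU₀c
  -- triangle 1: `B₁₀₀, B₀₁₀, B₀₀₁` pairwise disjoint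
  have E23 := d₂ false mS₀c mT₁ mU₀ mS₀c mT₀ mU₁        -- B₀₁₀ ∩ B₀₀₁ = ∅
  have E31 := d₃ false mS₀ mT₀c mU₁ mS₁ mU₀             -- B₀₀₁ ∩ B₁₀₀ = ∅
  rw [card_pair hb34, card_singleton, sumset_pair_single] at c011
  rw [card_pair hb12, card_singleton, sumset_pair_single] at c101
  rw [card_pair hb34, card_singleton, sumset_pair_single] at c110
  rw [sumset_pair_single, sumset_pair_single] at D12 D13 D23 E23 E31
  -- cover by triangle 2
  have cover : S₀.image (· + (b₃ + u')) ∪ S₀.image (· + (b₄ + u')) ∪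
      (S₁.image (· + (b₁ + u')) ∪ S₁.image (· + (b₂ + u'))) ∪
      (S₁.image (· + (b₃ + u)) ∪ S₁.image (· + (b₄ + u))) = univ := by
    apply eq_univ_of_card
    rw [card_union_of_disjoint (disjoint_union_left.2 ⟨D13, D23⟩), card_union_of_disjoint D12, c011, c101,
      c110, hA]
    ring
  -- the translated triples
  have e1 : (Equiv.mulRight (1 : G)).toEmbedding = Function.Embedding.refl G := by ext x; simp
  have hT' := h.map_mulRight 1 (τ 0) 1
  have hU' := h.map_mulRight 1 1 (τ 0)
  simp only [e1, Finset.map_refl] at hT' hU'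
  have memρ : ∀ (X : Finset G) (b : A), ρ b ∈ X.map (Equiv.mulRight (τ 0)).toEmbedding ↔ τ (-c₀ - b) ∈ X := by
    intro X b
    simp only [Finset.mem_map_equiv, Equiv.mulRight_symm_apply]
    rw [inv_tau hρρ hττ, hρτ, zero_sub]
  have memτ : ∀ (X : Finset G) (b : A), τ b ∈ X.map (Equiv.mulRight (τ 0)).toEmbedding ↔ ρ (-b) ∈ X := by
    intro X b
    simp only [Finset.mem_map_equiv, Equiv.mulRight_symm_apply]
    rw [inv_tau hρρ hττ, hττ]
    have e : c₀ + (0 - c₀) - b = -b := by abel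
    rw [e]
  have mT'₀ : ∀ b ∈ ({-c₀ - b₃, -c₀ - b₄} : Finset A), ρ b ∈ T.map (Equiv.mulRight (τ 0)).toEmbedding := by
    intro b hb
    rw [memρ]
    rcases mem_insert.1 hb with rfl | hb
    · rw [show -c₀ - (-c₀ - b₃) = b₃ by abel]; exact mT₁ b₃ (mem_insert_self _ _)
    · rw [mem_singleton] at hb; subst hb
      rw [show -c₀ - (-c₀ - b₄) = b₄ by abel]; exact mT₁ b₄ (mem_insert_of_mem (mem_singleton_self _))
  have mT'₁ : ∀ b ∈ ({-b₁, -b₂} : Finset A), τ b ∈ T.map (Equiv.mulRight (τ 0)).toEmbedding := by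
    intro b hb
    rw [memτ]
    rcases mem_insert.1 hb with rfl | hb
    · rw [neg_neg]; exact mT₀ b₁ (mem_insert_self _ _)
    · rw [mem_singleton] at hb; subst hb
      rw [neg_neg]; exact mT₀ b₂ (mem_insert_of_mem (mem_singleton_self _))
  have mT'₁c : ∀ b ∈ ({-b₁, -b₂} : Finset A), cond true (τ b) (ρ b) ∈ T.map (Equiv.mulRight (τ 0)).toEmbedding :=
    mT'₁
  have mU'₀ : ∀ c ∈ ({-c₀ - u'} : Finset A), ρ c ∈ U.map (Equiv.mulRight (τ 0)).toEmbedding := by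
    intro c hc
    rw [mem_singleton] at hc; subst hc
    rw [memρ, show -c₀ - (-c₀ - u') = u' by abel]; exact mU₁ u' (mem_singleton_self _)
  have mU'₁ : ∀ c ∈ ({-u} : Finset A), τ c ∈ U.map (Equiv.mulRight (τ 0)).toEmbedding := by
    intro c hc
    rw [mem_singleton] at hc; subst hc
    rw [memτ, neg_neg]; exact mU₀ u (mem_singleton_self _)
  have mU'₁c : ∀ c ∈ ({-u} : Finset A), cond true (τ c) (ρ c) ∈ U.map (Equiv.mulRight (τ 0)).toEmbedding := mU'₁
  -- (T1): triangle 2 of `(S, T·τ0, U)`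
  have dT₁ := disjoint_sumset₁' hρρ hρτ hτρ hττ hne hT'
  have dT₂ := disjoint_sumset₂' hρρ hρτ hτρ hττ hne hT'
  have dT₃ := disjoint_sumset₃' hρρ hρτ hτρ hττ hne hT'
  have K12 := (dT₁ true mS₁ mT'₀ mU₁c mS₀ mT'₁).symm     -- F1 ∩ F2 = ∅
  have K13 := dT₃ true mS₀ mT'₁c mU₁ mS₁ mU₀             -- F1 ∩ F3 = ∅
  have K23 := (dT₂ true mS₁c mT'₁ mU₀ mS₁c mT'₀ mU₁).symm -- F2 ∩ F3 = ∅
  rw [sumset_pair_single, sumset_pair_single] at K12 K13 K23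
  rw [neg_shift h2c] at K12 K23
  -- shift the (T1) pieces by `κ = b₁ + b₃`
  rw [← disjoint_image_add (b₁ + b₃), image_union, image_union, image_add_image, image_add_image,
    image_add_image, image_add_image] at K12 K13 K23
  rw [show -b₁ + u' + (b₁ + b₃) = b₃ + u' by abel] at K12 K13
  rw [show -b₁ + u + (b₁ + b₃) = b₃ + u by abel] at K13 K23
  -- (Per): triangle 2 of `(S, T, U·τ0)` + the base cover ⟹ `B₁₁₀ + c₀ = B₁₁₀`
  have dU₁ := disjoint_sumset₁' hρρ hρτ hτρ hττ hne hU'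
  have dU₂ := disjoint_sumset₂' hρρ hρτ hτρ hττ hne hU'
  have dU₃ := disjoint_sumset₃' hρρ hρτ hτρ hττ hne hU'
  have csU := card_sumset' hρρ hττ hρ hτ hU'
  have L12 := (dU₁ true mS₁ mT₀ mU'₁c mS₀ mT₁).symm
  have L13 := dU₃ true mS₀ mT₁c mU'₁ mS₁ mU'₀
  have L23 := (dU₂ true mS₁c mT₁ mU'₀ mS₁c mT₀ mU'₁).symm
  have l011 := csU false true true mS₀c mT₁c mU'₁c
  have l101 := csU true false true mS₁c mT₀c mU'₁c
  have mU'₀c : ∀ c ∈ ({-c₀ - u'} : Finset A), cond false (τ c) (ρ c) ∈ U.map (Equiv.mulRight (τ 0)).toEmbedding :=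
    mU'₀
  have l110 := csU true true false mS₁c mT₁c mU'₀c
  rw [card_pair hb34, card_singleton, sumset_pair_single] at l011
  rw [card_pair hb12, card_singleton, sumset_pair_single] at l101
  rw [card_pair hb34, card_singleton, sumset_pair_single] at l110
  rw [sumset_pair_single, sumset_pair_single] at L12 L13 L23
  have coverU : S₀.image (· + (b₃ + -u)) ∪ S₀.image (· + (b₄ + -u)) ∪
      (S₁.image (· + (b₁ + -u)) ∪ S₁.image (· + (b₂ + -u))) ∪
      (S₁.image (· + (b₃ + (-c₀ - u'))) ∪ S₁.image (· + (b₄ + (-c₀ - u')))) = univ := by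
    apply eq_univ_of_card
    rw [card_union_of_disjoint (disjoint_union_left.2 ⟨L13, L23⟩), card_union_of_disjoint L12, l011, l101,
      l110, hA]
    ring
  have per : ∀ x ∈ S₁.image (· + (b₃ + u)) ∪ S₁.image (· + (b₄ + u)),
      x + c₀ ∈ S₁.image (· + (b₃ + u)) ∪ S₁.image (· + (b₄ + u)) := by
    intro x hx
    have hx' : x - (u + u') ∈ (univ : Finset A) := mem_univ _
    rw [← coverU, mem_union, mem_union] at hx'
    rcases hx' with (h1 | h2) | h3
    · -- `x ∈ B₀₁₁`: contradiction with `B₀₁₁ ∩ B₁₁₀ = ∅`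
      exfalso
      have hx1 : x ∈ S₀.image (· + (b₃ + u')) ∪ S₀.image (· + (b₄ + u')) := by
        rcases mem_union.1 h1 with h | h
        · obtain ⟨s, hs, he⟩ := mem_image.1 h
          exact mem_union_left _ (mem_image.2 ⟨s, hs, by rw [eq_sub_iff_add_eq] at he; rw [← he]; abel⟩)
        · obtain ⟨s, hs, he⟩ := mem_image.1 h
          exact mem_union_right _ (mem_image.2 ⟨s, hs, by rw [eq_sub_iff_add_eq] at he; rw [← he]; abel⟩)
      exact disjoint_left.1 D13 hx1 hx
    · exfalso
      have hx1 : x ∈ S₁.image (· + (b₁ + u')) ∪ S₁.image (· + (b₂ + u')) := by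
        rcases mem_union.1 h2 with h | h
        · obtain ⟨s, hs, he⟩ := mem_image.1 h
          exact mem_union_left _ (mem_image.2 ⟨s, hs, by rw [eq_sub_iff_add_eq] at he; rw [← he]; abel⟩)
        · obtain ⟨s, hs, he⟩ := mem_image.1 h
          exact mem_union_right _ (mem_image.2 ⟨s, hs, by rw [eq_sub_iff_add_eq] at he; rw [← he]; abel⟩)
      exact disjoint_left.1 D23 hx1 hx
    · rcases mem_union.1 h3 with h | h
      · obtain ⟨s, hs, he⟩ := mem_image.1 h
        refine mem_union_left _ (mem_image.2 ⟨s, hs, ?_⟩)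
        rw [eq_sub_iff_add_eq] at he
        calc s + (b₃ + u) = s + (b₃ + (-c₀ - u')) + (u + u') + c₀ := by abel
          _ = x + c₀ := by rw [he]
      · obtain ⟨s, hs, he⟩ := mem_image.1 h
        refine mem_union_right _ (mem_image.2 ⟨s, hs, ?_⟩)
        rw [eq_sub_iff_add_eq] at he
        calc s + (b₄ + u) = s + (b₄ + (-c₀ - u')) + (u + u') + c₀ := by abel
          _ = x + c₀ := by rw [he]
  have hper0 : (S₁.image (· + (b₃ + u)) ∪ S₁.image (· + (b₄ + u))).image (· + c₀) =
      S₁.image (· + (b₃ + u)) ∪ S₁.image (· + (b₄ + u)) := by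
    apply eq_of_subset_of_card_le
    · intro z hz
      obtain ⟨x, hx, rfl⟩ := mem_image.1 hz
      exact per x hx
    · rw [card_image_of_injective _ (add_left_injective c₀)]
  -- move (Per) to `M = B₁₁₀ + λ`, `λ = (b₁ + u') - (b₃ + u)`
  have hper : (S₁.image (· + (b₁ + u')) ∪ S₁.image (· + (b₄ + u + ((b₁ + u') - (b₃ + u))))).image (· + c₀) =
      S₁.image (· + (b₁ + u')) ∪ S₁.image (· + (b₄ + u + ((b₁ + u') - (b₃ + u)))) := by
    have e : S₁.image (· + (b₁ + u')) ∪ S₁.image (· + (b₄ + u + ((b₁ + u') - (b₃ + u)))) =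
        (S₁.image (· + (b₃ + u)) ∪ S₁.image (· + (b₄ + u))).image (· + ((b₁ + u') - (b₃ + u))) := by
      rw [image_union, image_add_image, image_add_image, add_sub_cancel]
    rw [e, image_add_image, add_comm ((b₁ + u') - (b₃ + u)) c₀, ← image_add_image, hper0]
  -- (★): `B₀₀₁ + (u' - u) ⊆ B₁₁₀`
  have star : ∀ x ∈ S₀.image (· + (b₁ + u')) ∪ S₀.image (· + (b₂ + u')),
      x + (u' - u) ∈ S₁.image (· + (b₃ + u)) ∪ S₁.image (· + (b₄ + u)) := by
    intro x hx
    have hx' : x + (u' - u) ∈ (univ : Finset A) := mem_univ _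
    rw [← cover, mem_union, mem_union] at hx'
    rcases hx' with (h1 | h2) | h3
    · exfalso
      -- `x ∈ B₀₁₀ = S₀ + T₁ + u`
      have hx1 : x ∈ S₀.image (· + (b₃ + u)) ∪ S₀.image (· + (b₄ + u)) := by
        rcases mem_union.1 h1 with h | h
        · obtain ⟨s, hs, he⟩ := mem_image.1 h
          exact mem_union_left _ (mem_image.2 ⟨s, hs, by
            have := he; rw [← sub_eq_zero] at this ⊢; rw [← this]; abel⟩)
        · obtain ⟨s, hs, he⟩ := mem_image.1 h
          exact mem_union_right _ (mem_image.2 ⟨s, hs, by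
            have := he; rw [← sub_eq_zero] at this ⊢; rw [← this]; abel⟩)
      exact disjoint_left.1 E23 hx1 hx
    · exfalso
      -- `x ∈ B₁₀₀ = S₁ + T₀ + u`
      have hx1 : x ∈ S₁.image (· + (b₁ + u)) ∪ S₁.image (· + (b₂ + u)) := by
        rcases mem_union.1 h2 with h | h
        · obtain ⟨s, hs, he⟩ := mem_image.1 h
          exact mem_union_left _ (mem_image.2 ⟨s, hs, by
            have := he; rw [← sub_eq_zero] at this ⊢; rw [← this]; abel⟩)
        · obtain ⟨s, hs, he⟩ := mem_image.1 h
          exact mem_union_right _ (mem_image.2 ⟨s, hs, by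
            have := he; rw [← sub_eq_zero] at this ⊢; rw [← this]; abel⟩)
      exact disjoint_left.1 E31 hx hx1
    · exact h3
  have hsub : S₀.image (· + (b₁ + u' + ((u' - u) + ((b₁ + u') - (b₃ + u))))) ∪
      S₀.image (· + (b₂ + u' + ((u' - u) + ((b₁ + u') - (b₃ + u))))) ⊆
      S₁.image (· + (b₁ + u')) ∪ S₁.image (· + (b₄ + u + ((b₁ + u') - (b₃ + u)))) := by
    intro x hx
    have hx0 : x - ((u' - u) + ((b₁ + u') - (b₃ + u))) ∈ S₀.image (· + (b₁ + u')) ∪ S₀.image (· + (b₂ + u')) := by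
      rcases mem_union.1 hx with h | h
      · obtain ⟨s, hs, rfl⟩ := mem_image.1 h
        exact mem_union_left _ (mem_image.2 ⟨s, hs, by abel⟩)
      · obtain ⟨s, hs, rfl⟩ := mem_image.1 h
        exact mem_union_right _ (mem_image.2 ⟨s, hs, by abel⟩)
    have h1 := star _ hx0
    rcases mem_union.1 h1 with h | h
    · obtain ⟨s, hs, he⟩ := mem_image.1 h
      refine mem_union_left _ (mem_image.2 ⟨s, hs, ?_⟩)
      have := he; rw [← sub_eq_zero] at this ⊢; rw [← this]; abel
    · obtain ⟨s, hs, he⟩ := mem_image.1 h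
      refine mem_union_right _ (mem_image.2 ⟨s, hs, ?_⟩)
      have := he; rw [← sub_eq_zero] at this ⊢; rw [← this]; abel
  -- injectivity inside the parts
  have iS₁t : Disjoint S₁ (S₁.image (· + (b₂ + u' - (b₁ + u')))) :=
    disjoint_of_translates ((card_union_eq_card_add_card).1 (by rw [c101, card_image_add, card_image_add]; ring))
  have iS₁t' : Disjoint S₁ (S₁.image (· + (b₄ + u - (b₃ + u)))) :=
    disjoint_of_translates ((card_union_eq_card_add_card).1 (by rw [c110, card_image_add, card_image_add]; ring))
  have iS₀t' : Disjoint S₀ (S₀.image (· + (b₄ + u' - (b₃ + u')))) :=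
    disjoint_of_translates ((card_union_eq_card_add_card).1 (by rw [c011, card_image_add, card_image_add]; ring))
  have c001 := cs false false true mS₀c mT₀c mU₁c
  rw [card_pair hb12, card_singleton, sumset_pair_single] at c001
  have iS₀t : Disjoint S₀ (S₀.image (· + (b₂ + u' - (b₁ + u')))) :=
    disjoint_of_translates ((card_union_eq_card_add_card).1 (by rw [c001, card_image_add, card_image_add]; ring))
  -- assemble
  refine quot_cyclic_of_shapeB_offsets (S₀ := S₀) (S₁ := S₁)
    (t := b₂ + u' - (b₁ + u')) (t' := b₄ + u - (b₃ + u)) (d := (b₃ + u) - (b₁ + u')) (c₀ := c₀)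
    (y₀ := b₁ + u') (q₀ := b₁ + u' + ((u' - u) + ((b₁ + u') - (b₃ + u))))
    (o₁ := b₃ + u') (o₂ := b₄ + u') (o₃ := b₂ + u') (o₄ := b₃ + u) (o₅ := b₄ + u)
    (o₆ := -b₂ + u' + (b₁ + b₃)) (o₇ := c₀ - b₃ + u' + (b₁ + b₃)) (o₈ := c₀ - b₄ + u' + (b₁ + b₃))
    (o₉ := -b₂ + u + (b₁ + b₃)) (o₁₀ := b₄ + u + ((b₁ + u') - (b₃ + u)))
    (o₁₁ := b₂ + u' + ((u' - u) + ((b₁ + u') - (b₃ + u))))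
    (by abel) (by abel) (by abel) (by abel) (by abel) (by abel) (by abel) (by abel) (by abel) (by abel) (by abel)
    iS₁t iS₁t' iS₀t ?_ hS hA D12 D13 D23 K12 K13 K23 hper hsub hc₀ h2c
  convert iS₀t' using 3; abel

/-- Mirrored orientation of `quot_cyclic_of_shapeB_tpp`: parts `(c+1, c | 2, 2 | 1, 1)`, `c₀ ≠ 0`. [folklore] -/
theorem quot_cyclic_of_shapeB_tpp'
    (hρρ : ∀ a b, ρ a * ρ b = ρ (a + b)) (hρτ : ∀ a b, ρ a * τ b = τ (b - a))
    (hτρ : ∀ a b, τ a * ρ b = τ (a + b)) (hττ : ∀ a b, τ a * τ b = ρ (c₀ + b - a))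
    (hρ : Function.Injective ρ) (hτ : Function.Injective τ) (hne : ∀ a b, ρ a ≠ τ b)
    (hsurj : ∀ g, (∃ a, ρ a = g) ∨ (∃ a, τ a = g)) (h : TripleProductProperty S T U)
    (hS : (univ.filter fun a : A => ρ a ∈ S).card = (univ.filter fun a : A => τ a ∈ S).card + 1)
    (hT₀ : (univ.filter fun a : A => ρ a ∈ T).card = 2) (hT₁ : (univ.filter fun a : A => τ a ∈ T).card = 2)
    (hU₀ : (univ.filter fun a : A => ρ a ∈ U).card = 1) (hU₁ : (univ.filter fun a : A => τ a ∈ U).card = 1)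
    (hV : 3 * (S.card * T.card * U.card) + 8 = 8 * Fintype.card A) (hc₀ : c₀ ≠ 0) :
    ∃ g : A, ∀ x : A, x ∈ AddSubgroup.zmultiples g ∨ x + c₀ ∈ AddSubgroup.zmultiples g := by
  have h' := tpp_map_mulLeft h (τ 0)
  have rS := card_rho_part_mulLeft_tau hρρ hτρ hττ (c₀ := c₀) S
  have tS := card_tau_part_mulLeft_tau hρρ hρτ hτρ hττ hτ S
  have rT := card_rho_part_mulLeft_tau hρρ hτρ hττ (c₀ := c₀) T
  have tT := card_tau_part_mulLeft_tau hρρ hρτ hτρ hττ hτ T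
  have rU := card_rho_part_mulLeft_tau hρρ hτρ hττ (c₀ := c₀) U
  have tU := card_tau_part_mulLeft_tau hρρ hρτ hτρ hττ hτ U
  refine quot_cyclic_of_shapeB_tpp hρρ hρτ hτρ hττ hρ hτ hne hsurj h' ?_ ?_ ?_ ?_ ?_ ?_ hc₀
  · rw [tS, rS, hS]
  · rw [rT, hT₁]
  · rw [tT, hT₀]
  · rw [rU, hU₁]
  · rw [tU, hU₀]
  · simpa only [card_map] using hV

/-- Both orientations of shape `(c, c±1 | 2, 2 | 1, 1)` at `c₀ ≠ 0`: `A = ⟨g⟩ ∪ (c₀ + ⟨g⟩)`. [folklore] -/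
theorem quot_cyclic_of_shapeB_tpp_or
    (hρρ : ∀ a b, ρ a * ρ b = ρ (a + b)) (hρτ : ∀ a b, ρ a * τ b = τ (b - a))
    (hτρ : ∀ a b, τ a * ρ b = τ (a + b)) (hττ : ∀ a b, τ a * τ b = ρ (c₀ + b - a))
    (hρ : Function.Injective ρ) (hτ : Function.Injective τ) (hne : ∀ a b, ρ a ≠ τ b)
    (hsurj : ∀ g, (∃ a, ρ a = g) ∨ (∃ a, τ a = g)) (h : TripleProductProperty S T U)
    (hS : (univ.filter fun a : A => τ a ∈ S).card = (univ.filter fun a : A => ρ a ∈ S).card + 1 ∨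
      (univ.filter fun a : A => ρ a ∈ S).card = (univ.filter fun a : A => τ a ∈ S).card + 1)
    (hT₀ : (univ.filter fun a : A => ρ a ∈ T).card = 2) (hT₁ : (univ.filter fun a : A => τ a ∈ T).card = 2)
    (hU₀ : (univ.filter fun a : A => ρ a ∈ U).card = 1) (hU₁ : (univ.filter fun a : A => τ a ∈ U).card = 1)
    (hV : 3 * (S.card * T.card * U.card) + 8 = 8 * Fintype.card A) (hc₀ : c₀ ≠ 0) :
    ∃ g : A, ∀ x : A, x ∈ AddSubgroup.zmultiples g ∨ x + c₀ ∈ AddSubgroup.zmultiples g := by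
  rcases hS with hS | hS
  · exact quot_cyclic_of_shapeB_tpp hρρ hρτ hτρ hττ hρ hτ hne hsurj h hS hT₀ hT₁ hU₀ hU₁ hV hc₀
  · exact quot_cyclic_of_shapeB_tpp' hρρ hρτ hτρ hττ hρ hτ hne hsurj h hS hT₀ hT₁ hU₀ hU₁ hV hc₀

end DihedralLike

end Summit.MatrixMultiplication.OmegaCensus
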